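import Summits.QuantumFields.BalabanUV.T4Continuum.Support.NE7CriticalSliceAdapter
import Summits.QuantumFields.BalabanUV.T4Continuum.Support.MinimalActionCompact
import Mathlib.Topology.Order.Compact
import HarnessLib

/-!
# NE7CritContinuityMethod — CRIT-ONE-STEP BY THE CONTINUITY METHOD ALONG A DATA PATH: the clopen induction on `[0,1]` in kernel, with the
# CLOSED half DISCHARGED by compactness of the class (row NE3's `MinimalActionCompact`) down to ONE displayed letter — «ker-criticality is a
# closed condition on the class» — and the OPEN half (a-priori estimate + local continuation) displayed as the other letter

Cell `pub-balaban`, rung (B)+1 sub-cell t4, lineage `b2b-balaban-t4-ne7-p1`, generation 67 (CRUX PROVER NE7 #1); hunt (h11), memo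
`t4/b2b-balaban-t4-ne7-p1-g67/HUNT-H11-NORMAL-CURRENCY.md` §3 «LOCAL-FLAT (ii) made precise».  File F16.

THE POINT.  After F15, ONE-STEP ⇐ CRIT-ONE-STEP ∧ REP_w, and CRIT-ONE-STEP (∃ an admissible `U♯` with `SmallField U♯ (δη²)`, critical on
`ker levelQ'`) is in print the output of [Balaban1985Variational] Sects. C–E: a contraction around the curved background `U₀` over the `L^∞`
propagator bounds of B11's ref. [5] (CMP 99), then Sect. F.  THIS FILE replaces the contraction by SOFT TOPOLOGY: existence of the critical
configuration is CONTINUED along a path of data `γ : [0,1] → configurations` from a datum `γ 0` where it is known (e.g. flat) to `γ 1 = V`.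
The set `S = {τ ∈ [0,1] : ∃ U, Crit(γ τ, U)}` is
* CLOSED — proved here: `S` is the projection to `[0,1]` of a closed subset of the COMPACT set `[0,1] × sfClass d L N ε (k+1)`
  (`MinimalActionCompact.isCompact_sfClass`; admissibility `avgIter L U (k+1) = γ τ` is closed because `avgIter` is continuous ON THE CLASS,
  `MinimalActionCompact.continuousOn_avgIter`, and `γ` is continuous; the radius is closed, `isClosed_smallField`), GIVEN the one letter
  (CRIT-CLOSED) «`{U ∈ sfClass | U is critical on ker levelQ'}` is closed» — true (the constraint differential is onto and continuous on the class,
  `AveragingDeficitMultiLevelFermat.levelQ'_onto` ∕ `fderiv_coord_resDir`) but NOT proved in this file;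
* relatively OPEN — the letter (OPEN): local continuation of a critical small configuration to nearby data WITH the radius `δη²` kept — in any proof
  = the A-PRIORI ESTIMATE with margin (B11 Sect. F TYPE, LOCAL-FLAT (i)) + the finite-dimensional implicit function theorem on a gauge slice
  (non-degeneracy = F1's `hess_vary_ge_of_poincare` + the multiplier letter); NOT proved here;
* and contains `0` — hence is all of `[0,1]` (`isPreconnected_Icc`).  NO competitor, NO background field, NO propagator enters.

WHAT ([folklore]; 0 def, 0 sorry; four theorems).
§1 `Icc_subset_of_closed_of_relOpen` — the clopen induction on `[0,1]` (pure topology).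
§2 `isClosed_critSet_param` — for `γ` continuous on `[0,1]`: the set of `τ ∈ [0,1]` carrying an admissible (class `sfClass d L N ε`, level `k+1`,
   datum `γ τ`) configuration with `SmallField · r` that is critical on `ker (levelQ' L N k ·)` is CLOSED, given (CRIT-CLOSED).  Compactness of
   the class and continuity of the `(k+1)`-fold average on it BY NAME (row NE3, `MinimalActionCompact`); smallness `16·C₀·ε ≤ 3`,
   `1024(d+1)(d+4)L²ε ≤ 1`, `L ≥ 2` are that file's (domain of the series (21) along the tower).
§3 **`critOneStep_of_continuity`** — CRIT-ONE-STEP at every point of the path, in particular at `V = γ 1` (`critOneStep_at_one`), from: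
   a continuous data path `γ` on `[0,1]`, CRIT-ONE-STEP at `γ 0`, (CRIT-CLOSED), (OPEN).
HONEST FRAMING (page 1).  Soft topology over two displayed letters; (OPEN) carries ALL the analysis (a-priori estimate + IFT) and is asserted for
nothing; (CRIT-CLOSED) is routine but open; the data path (small data connected to a flat datum through small data) is a HYPOTHESIS (`γ`,
`h0`).  NOT CRIT-ONE-STEP, NOT ONE-STEP, NOT NE7; spine 0∕9; finite T⁴ rung (B)+1 — NOT infinite volume, NOT mass gap, NOT Clay.  Continuum YM on
T⁴ ⇐ BetaPertH ∧ nine spine estimates (0/9 proved); BetaPertH ⇐ (D1) ∧ (D4) ∧ CAP+tail; G-an2-4 gates asym, D1 and NE2/3/4.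
-/

set_option autoImplicit false

open scoped BigOperators Matrix Matrix.Norms.L2Operator Topology
open NormedSpace Finset Set

namespace Summit.QuantumFields.BalabanUV.T4Continuum.NE7CritContinuityMethod

open Literature.MathematicalPhysics.QuantumFieldTheory.Balaban1983to89
open B7Prop1Explicit B7Prop2Explicit MatrixLog UnitaryModel
open T4AveragingDeficitWall (IsUnitaryCfg IsSkewDir SmallField fineAction vary curl curlSq dirSq)
open T4AveragingDeficitWallBoundary (IsPeriodicCfg periodBox)
open AveragingDeficitTorusChart (TDir extDir)
open AveragingDeficitMultiLevelPrep (tower LevelSmall levelQ')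
open MinimalActionLevels (levelAction perWin)
open MinimalActionSandwich (IsMinimiser admissible)
open MinimalActionRate (sfClass)
open MinimalActionCompact (isCompact_sfClass continuousOn_avgIter isClosed_smallField)
open NE3HessForm (dAction)

noncomputable section

variable {d : ℕ} {n : Type*} [Fintype n] [DecidableEq n]

/-! ## §1 The clopen induction on `[0,1]` -/

/-- **CLOPEN INDUCTION ON `[0,1]`**: a closed `S ⊆ ℝ` containing `0` that is relatively open in `[0,1]` (every point of `S ∩ [0,1]` has a ball whose
trace on `[0,1]` lies in `S`) contains `[0,1]` — `isPreconnected_Icc`. [folklore] -/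
theorem Icc_subset_of_closed_of_relOpen {S : Set ℝ} (h0 : (0 : ℝ) ∈ S) (hcl : IsClosed S)
    (hop : ∀ τ₀ ∈ Icc (0 : ℝ) 1, τ₀ ∈ S → ∃ ρ : ℝ, 0 < ρ ∧ ∀ τ ∈ Icc (0 : ℝ) 1, |τ - τ₀| < ρ → τ ∈ S) :
    Icc (0 : ℝ) 1 ⊆ S := by
  -- the open set `u` = union of the balls supplied by `hop`
  set u : Set ℝ := ⋃ τ₀ ∈ Icc (0 : ℝ) 1 ∩ S,
    ⋃ ρ ∈ {ρ : ℝ | 0 < ρ ∧ ∀ τ ∈ Icc (0 : ℝ) 1, |τ - τ₀| < ρ → τ ∈ S}, Metric.ball τ₀ ρ with hu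
  have huo : IsOpen u := by
    rw [hu]
    exact isOpen_biUnion fun _ _ => isOpen_biUnion fun _ _ => Metric.isOpen_ball
  have huS : Icc (0 : ℝ) 1 ∩ u ⊆ S := by
    rintro τ ⟨hτI, hτu⟩
    rw [hu] at hτu
    simp only [mem_iUnion, mem_setOf_eq, exists_prop] at hτu
    obtain ⟨τ₀, -, ρ, ⟨-, hρ⟩, hball⟩ := hτu
    exact hρ τ hτI (by simpa [Real.dist_eq] using Metric.mem_ball.mp hball)
  have hSu : Icc (0 : ℝ) 1 ∩ S ⊆ u := by
    rintro τ₀ ⟨hτ₀I, hτ₀S⟩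
    obtain ⟨ρ, hρ, hball⟩ := hop τ₀ hτ₀I hτ₀S
    rw [hu]
    simp only [mem_iUnion, mem_setOf_eq, exists_prop]
    exact ⟨τ₀, ⟨hτ₀I, hτ₀S⟩, ρ, ⟨hρ, hball⟩, Metric.mem_ball_self hρ⟩
  intro τ hτ
  by_contra hτS
  have hcover : Icc (0 : ℝ) 1 ⊆ u ∪ Sᶜ := fun x hx => by
    by_cases hxS : x ∈ S
    · exact Or.inl (hSu ⟨hx, hxS⟩)
    · exact Or.inr hxS
  have h0I : (0 : ℝ) ∈ Icc (0 : ℝ) 1 := ⟨le_rfl, zero_le_one⟩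
  obtain ⟨x, hxI, hxu, hxSc⟩ :=
    isPreconnected_Icc u Sᶜ huo hcl.isOpen_compl hcover ⟨0, h0I, hSu ⟨h0I, h0⟩⟩ ⟨τ, hτ, hτS⟩
  exact hxSc (huS ⟨hxI, hxu⟩)

/-! ## §2 The CLOSED half: projection of a closed subset of the compact `[0,1] × sfClass` -/

/-- **THE SET OF PATH PARAMETERS CARRYING A CRITICAL SMALL ADMISSIBLE CONFIGURATION IS CLOSED** (given (CRIT-CLOSED)).  See the module docstring,
§2: `S = fst '' Z`, `Z ⊆ [0,1] × sfClass d L N ε (k+1)` closed (admissibility through `continuousOn_avgIter` and the continuity of `γ`; the radius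
through `isClosed_smallField`; criticality through the letter `hcc`), hence compact, hence `S` is compact and closed. [folklore] -/
theorem isClosed_critSet_param [Nonempty n] {L N k : ℕ} [NeZero L] [NeZero N] (hL : 2 ≤ L) {ε r : ℝ} (hε0 : 0 ≤ ε)
    (hε1 : 16 * C0 d * ε ≤ 3) (hε2 : 1024 * (d + 1) * (d + 4) * (L : ℝ) ^ 2 * ε ≤ 1)
    (γ : ℝ → (Site d → Fin d → (Matrix n n ℂ)ˣ)) (hγ : ContinuousOn γ (Icc (0 : ℝ) 1))
    (hcc : IsClosed {U : Site d → Fin d → (Matrix n n ℂ)ˣ | U ∈ sfClass d L N ε (k + 1) ∧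
      ∀ Φ : TDir d n (L * tower L N k), (∀ r' κ, Φ r' κ ∈ skewAdjoint (Matrix n n ℂ)) →
        levelQ' L N k U Φ = 0 → dAction U (extDir (L * tower L N k) Φ) (perWin d (N * L ^ (k + 1))) = 0}) :
    IsClosed {τ : ℝ | τ ∈ Icc (0 : ℝ) 1 ∧ ∃ U : Site d → Fin d → (Matrix n n ℂ)ˣ,
      U ∈ admissible (sfClass d L N ε) L (k + 1) (γ τ) ∧ SmallField U r ∧
      ∀ Φ : TDir d n (L * tower L N k), (∀ r' κ, Φ r' κ ∈ skewAdjoint (Matrix n n ℂ)) →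
        levelQ' L N k U Φ = 0 → dAction U (extDir (L * tower L N k) Φ) (perWin d (N * L ^ (k + 1))) = 0} := by
  -- the compact box
  set K : Set (ℝ × (Site d → Fin d → (Matrix n n ℂ)ˣ)) := Icc (0 : ℝ) 1 ×ˢ sfClass d L N ε (k + 1) with hK
  have hKc : IsCompact K := isCompact_Icc.prod (isCompact_sfClass (d := d) (n := n) L N ε (k + 1))
  have hKcl : IsClosed K := hKc.isClosed
  -- admissibility is closed on the box: `(avgIter ∘ snd, γ ∘ fst)` is continuous on `K`, the diagonal is closed
  have havg : ContinuousOn (fun U : Site d → Fin d → (Matrix n n ℂ)ˣ => avgIter L U (k + 1)) (sfClass d L N ε (k + 1)) :=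
    (continuousOn_avgIter (d := d) (n := n) hL hε0 hε1 hε2 (k + 1) (k + 1) le_rfl).mono fun U hU => ⟨hU.1, hU.2.2⟩
  have hG : ContinuousOn (fun p : ℝ × (Site d → Fin d → (Matrix n n ℂ)ˣ) => (avgIter L p.2 (k + 1), γ p.1)) K := by
    refine ContinuousOn.prodMk ?_ ?_
    · exact havg.comp continuousOn_snd fun p hp => (mem_prod.mp hp).2
    · exact hγ.comp continuousOn_fst fun p hp => (mem_prod.mp hp).1
  have hA : IsClosed (K ∩ (fun p : ℝ × (Site d → Fin d → (Matrix n n ℂ)ˣ) => (avgIter L p.2 (k + 1), γ p.1)) ⁻¹'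
      (Set.diagonal (Site d → Fin d → (Matrix n n ℂ)ˣ))) :=
    hG.preimage_isClosed_of_isClosed hKcl isClosed_diagonal
  have hB : IsClosed ((Prod.snd : ℝ × (Site d → Fin d → (Matrix n n ℂ)ˣ) → _) ⁻¹'
      {U : Site d → Fin d → (Matrix n n ℂ)ˣ | SmallField U r}) :=
    (isClosed_smallField (d := d) (n := n) r).preimage continuous_snd
  have hC := hcc.preimage (continuous_snd : Continuous (Prod.snd : ℝ × (Site d → Fin d → (Matrix n n ℂ)ˣ) → _))
  -- the closed set `Z` and its projection
  set Z : Set (ℝ × (Site d → Fin d → (Matrix n n ℂ)ˣ)) :=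
    (K ∩ (fun p : ℝ × (Site d → Fin d → (Matrix n n ℂ)ˣ) => (avgIter L p.2 (k + 1), γ p.1)) ⁻¹'
      (Set.diagonal (Site d → Fin d → (Matrix n n ℂ)ˣ))) ∩
    ((Prod.snd : ℝ × (Site d → Fin d → (Matrix n n ℂ)ˣ) → _) ⁻¹' {U : Site d → Fin d → (Matrix n n ℂ)ˣ | SmallField U r}) ∩
    ((Prod.snd : ℝ × (Site d → Fin d → (Matrix n n ℂ)ˣ) → _) ⁻¹'
      {U : Site d → Fin d → (Matrix n n ℂ)ˣ | U ∈ sfClass d L N ε (k + 1) ∧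
        ∀ Φ : TDir d n (L * tower L N k), (∀ r' κ, Φ r' κ ∈ skewAdjoint (Matrix n n ℂ)) →
          levelQ' L N k U Φ = 0 → dAction U (extDir (L * tower L N k) Φ) (perWin d (N * L ^ (k + 1))) = 0}) with hZ
  have hZcl : IsClosed Z := (hA.inter hB).inter hC
  have hZK : Z ⊆ K := fun p hp => hp.1.1.1
  have hZc : IsCompact Z := hKc.of_isClosed_subset hZcl hZK
  have hSc : IsCompact (Prod.fst '' Z) := hZc.image continuous_fst
  -- identify the projection with the set of the statement
  have hset : {τ : ℝ | τ ∈ Icc (0 : ℝ) 1 ∧ ∃ U : Site d → Fin d → (Matrix n n ℂ)ˣ,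
      U ∈ admissible (sfClass d L N ε) L (k + 1) (γ τ) ∧ SmallField U r ∧
      ∀ Φ : TDir d n (L * tower L N k), (∀ r' κ, Φ r' κ ∈ skewAdjoint (Matrix n n ℂ)) →
        levelQ' L N k U Φ = 0 → dAction U (extDir (L * tower L N k) Φ) (perWin d (N * L ^ (k + 1))) = 0}
      = Prod.fst '' Z := by
    ext τ
    simp only [mem_setOf_eq, mem_image, Prod.exists, exists_and_right, exists_eq_right]
    constructor
    · rintro ⟨hτI, U, ⟨hUcl, hUavg⟩, hUr, hUcrit⟩
      refine ⟨U, ?_⟩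
      rw [hZ]
      refine ⟨⟨⟨?_, ?_⟩, hUr⟩, ⟨hUcl, hUcrit⟩⟩
      · rw [hK]; exact mem_prod.mpr ⟨hτI, hUcl⟩
      · exact Set.mem_preimage.mpr (Set.mem_diagonal_iff.mpr hUavg)
    · rintro ⟨U, hp⟩
      rw [hZ] at hp
      obtain ⟨⟨⟨hpK, hpA⟩, hpr⟩, ⟨hUcl, hUcrit⟩⟩ := hp
      rw [hK] at hpK
      obtain ⟨hτI, -⟩ := mem_prod.mp hpK
      have hUavg : avgIter L U (k + 1) = γ τ := Set.mem_diagonal_iff.mp (Set.mem_preimage.mp hpA)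
      exact ⟨hτI, U, ⟨hUcl, hUavg⟩, hpr, hUcrit⟩
  rw [hset]
  exact hSc.isClosed

/-! ## §3 CRIT-ONE-STEP along the path -/

/-- **CRIT-ONE-STEP BY CONTINUITY ALONG A DATA PATH.**  At level `k+1` of the class `sfClass d L N ε` (`L ≥ 2`, `ε` in the domain of
`MinimalActionCompact`), let `γ` be a data path continuous on `[0,1]` such that AT `γ 0` some admissible configuration with `SmallField · r` is
critical on `ker (levelQ' L N k ·)`.  ASSUME (CRIT-CLOSED) `hcc` and (OPEN) `hopen`: whenever `τ₀ ∈ [0,1]` carries such a configuration, so does every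
`τ ∈ [0,1]` with `|τ − τ₀| < ρ` for some `ρ > 0` (a-priori estimate with margin + local continuation — the letter carrying ALL the analysis).  THEN
every `τ ∈ [0,1]` carries one.  See the module docstring. [folklore] -/
theorem critOneStep_of_continuity [Nonempty n] {L N k : ℕ} [NeZero L] [NeZero N] (hL : 2 ≤ L) {ε r : ℝ} (hε0 : 0 ≤ ε)
    (hε1 : 16 * C0 d * ε ≤ 3) (hε2 : 1024 * (d + 1) * (d + 4) * (L : ℝ) ^ 2 * ε ≤ 1)
    (γ : ℝ → (Site d → Fin d → (Matrix n n ℂ)ˣ)) (hγ : ContinuousOn γ (Icc (0 : ℝ) 1))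
    (h0 : ∃ U : Site d → Fin d → (Matrix n n ℂ)ˣ, U ∈ admissible (sfClass d L N ε) L (k + 1) (γ 0) ∧ SmallField U r ∧
      ∀ Φ : TDir d n (L * tower L N k), (∀ r' κ, Φ r' κ ∈ skewAdjoint (Matrix n n ℂ)) →
        levelQ' L N k U Φ = 0 → dAction U (extDir (L * tower L N k) Φ) (perWin d (N * L ^ (k + 1))) = 0)
    (hcc : IsClosed {U : Site d → Fin d → (Matrix n n ℂ)ˣ | U ∈ sfClass d L N ε (k + 1) ∧
      ∀ Φ : TDir d n (L * tower L N k), (∀ r' κ, Φ r' κ ∈ skewAdjoint (Matrix n n ℂ)) →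
        levelQ' L N k U Φ = 0 → dAction U (extDir (L * tower L N k) Φ) (perWin d (N * L ^ (k + 1))) = 0})
    (hopen : ∀ τ₀ ∈ Icc (0 : ℝ) 1,
      (∃ U : Site d → Fin d → (Matrix n n ℂ)ˣ, U ∈ admissible (sfClass d L N ε) L (k + 1) (γ τ₀) ∧ SmallField U r ∧
        ∀ Φ : TDir d n (L * tower L N k), (∀ r' κ, Φ r' κ ∈ skewAdjoint (Matrix n n ℂ)) →
          levelQ' L N k U Φ = 0 → dAction U (extDir (L * tower L N k) Φ) (perWin d (N * L ^ (k + 1))) = 0) →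
      ∃ ρ : ℝ, 0 < ρ ∧ ∀ τ ∈ Icc (0 : ℝ) 1, |τ - τ₀| < ρ →
        ∃ U : Site d → Fin d → (Matrix n n ℂ)ˣ, U ∈ admissible (sfClass d L N ε) L (k + 1) (γ τ) ∧ SmallField U r ∧
          ∀ Φ : TDir d n (L * tower L N k), (∀ r' κ, Φ r' κ ∈ skewAdjoint (Matrix n n ℂ)) →
            levelQ' L N k U Φ = 0 → dAction U (extDir (L * tower L N k) Φ) (perWin d (N * L ^ (k + 1))) = 0) :
    ∀ τ ∈ Icc (0 : ℝ) 1, ∃ U : Site d → Fin d → (Matrix n n ℂ)ˣ, U ∈ admissible (sfClass d L N ε) L (k + 1) (γ τ) ∧ SmallField U r ∧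
      ∀ Φ : TDir d n (L * tower L N k), (∀ r' κ, Φ r' κ ∈ skewAdjoint (Matrix n n ℂ)) →
        levelQ' L N k U Φ = 0 → dAction U (extDir (L * tower L N k) Φ) (perWin d (N * L ^ (k + 1))) = 0 := by
  set S : Set ℝ := {τ : ℝ | τ ∈ Icc (0 : ℝ) 1 ∧ ∃ U : Site d → Fin d → (Matrix n n ℂ)ˣ,
      U ∈ admissible (sfClass d L N ε) L (k + 1) (γ τ) ∧ SmallField U r ∧
      ∀ Φ : TDir d n (L * tower L N k), (∀ r' κ, Φ r' κ ∈ skewAdjoint (Matrix n n ℂ)) →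
        levelQ' L N k U Φ = 0 → dAction U (extDir (L * tower L N k) Φ) (perWin d (N * L ^ (k + 1))) = 0} with hS
  have hcl : IsClosed S := by rw [hS]; exact isClosed_critSet_param hL hε0 hε1 hε2 γ hγ hcc
  have h0S : (0 : ℝ) ∈ S := by rw [hS]; exact ⟨⟨le_rfl, zero_le_one⟩, h0⟩
  have hop : ∀ τ₀ ∈ Icc (0 : ℝ) 1, τ₀ ∈ S → ∃ ρ : ℝ, 0 < ρ ∧ ∀ τ ∈ Icc (0 : ℝ) 1, |τ - τ₀| < ρ → τ ∈ S := by
    intro τ₀ hτ₀I hτ₀S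
    rw [hS] at hτ₀S
    obtain ⟨ρ, hρ, hball⟩ := hopen τ₀ hτ₀I hτ₀S.2
    refine ⟨ρ, hρ, fun τ hτI hτρ => ?_⟩
    rw [hS]
    exact ⟨hτI, hball τ hτI hτρ⟩
  intro τ hτ
  have hτS := Icc_subset_of_closed_of_relOpen h0S hcl hop hτ
  rw [hS] at hτS
  exact hτS.2

/-- **CRIT-ONE-STEP AT THE END OF THE PATH** (`τ = 1`, datum `V = γ 1`): the `∃ U♯`-clause of F15's `hcrit` (criticality on `ker levelQ'`,
radius `r`, admissibility) for the datum `γ 1`, from the continuity method. [folklore] -/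
theorem critOneStep_at_one [Nonempty n] {L N k : ℕ} [NeZero L] [NeZero N] (hL : 2 ≤ L) {ε r : ℝ} (hε0 : 0 ≤ ε)
    (hε1 : 16 * C0 d * ε ≤ 3) (hε2 : 1024 * (d + 1) * (d + 4) * (L : ℝ) ^ 2 * ε ≤ 1)
    (γ : ℝ → (Site d → Fin d → (Matrix n n ℂ)ˣ)) (hγ : ContinuousOn γ (Icc (0 : ℝ) 1))
    (h0 : ∃ U : Site d → Fin d → (Matrix n n ℂ)ˣ, U ∈ admissible (sfClass d L N ε) L (k + 1) (γ 0) ∧ SmallField U r ∧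
      ∀ Φ : TDir d n (L * tower L N k), (∀ r' κ, Φ r' κ ∈ skewAdjoint (Matrix n n ℂ)) →
        levelQ' L N k U Φ = 0 → dAction U (extDir (L * tower L N k) Φ) (perWin d (N * L ^ (k + 1))) = 0)
    (hcc : IsClosed {U : Site d → Fin d → (Matrix n n ℂ)ˣ | U ∈ sfClass d L N ε (k + 1) ∧
      ∀ Φ : TDir d n (L * tower L N k), (∀ r' κ, Φ r' κ ∈ skewAdjoint (Matrix n n ℂ)) →
        levelQ' L N k U Φ = 0 → dAction U (extDir (L * tower L N k) Φ) (perWin d (N * L ^ (k + 1))) = 0})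
    (hopen : ∀ τ₀ ∈ Icc (0 : ℝ) 1,
      (∃ U : Site d → Fin d → (Matrix n n ℂ)ˣ, U ∈ admissible (sfClass d L N ε) L (k + 1) (γ τ₀) ∧ SmallField U r ∧
        ∀ Φ : TDir d n (L * tower L N k), (∀ r' κ, Φ r' κ ∈ skewAdjoint (Matrix n n ℂ)) →
          levelQ' L N k U Φ = 0 → dAction U (extDir (L * tower L N k) Φ) (perWin d (N * L ^ (k + 1))) = 0) →
      ∃ ρ : ℝ, 0 < ρ ∧ ∀ τ ∈ Icc (0 : ℝ) 1, |τ - τ₀| < ρ →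
        ∃ U : Site d → Fin d → (Matrix n n ℂ)ˣ, U ∈ admissible (sfClass d L N ε) L (k + 1) (γ τ) ∧ SmallField U r ∧
          ∀ Φ : TDir d n (L * tower L N k), (∀ r' κ, Φ r' κ ∈ skewAdjoint (Matrix n n ℂ)) →
            levelQ' L N k U Φ = 0 → dAction U (extDir (L * tower L N k) Φ) (perWin d (N * L ^ (k + 1))) = 0) :
    ∃ U : Site d → Fin d → (Matrix n n ℂ)ˣ, U ∈ admissible (sfClass d L N ε) L (k + 1) (γ 1) ∧ SmallField U r ∧
      ∀ Φ : TDir d n (L * tower L N k), (∀ r' κ, Φ r' κ ∈ skewAdjoint (Matrix n n ℂ)) →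
        levelQ' L N k U Φ = 0 → dAction U (extDir (L * tower L N k) Φ) (perWin d (N * L ^ (k + 1))) = 0 :=
  critOneStep_of_continuity hL hε0 hε1 hε2 γ hγ h0 hcc hopen 1 ⟨zero_le_one, le_rfl⟩

end

end Summit.QuantumFields.BalabanUV.T4Continuum.NE7CritContinuityMethod
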